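import Mathlib.MeasureTheory.Integral.IntervalIntegral.Basic
import Mathlib.Analysis.SpecialFunctions.Integrals.Basic
import Mathlib.Analysis.SpecialFunctions.Complex.LogDeriv
import Mathlib.Analysis.Complex.RealDeriv
import Mathlib.Analysis.Calculus.Deriv.Shift
import Literature.NumberTheory.LFunctions.BookerLemma
import HarnessLib

/-!
# Booker's lemma (Trudgian 2011, Lemma 2.10) — proof, part 1: evaluation of the integral

Infrastructure for the proof of the named fact
`Literature.NumberTheory.LFunctions.Trudgian2011_lemma_2_10` (file `BookerLemma.lean`).
Following the proof sketch of [Booker 2006, Lemma 4.4] we introduce the analytic function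

  `𝓕(z) = Λ(z+2) − Λ(z−2) − 2Λ(z+1) + 2Λ(z−1)`,  `Λ(w) = w log w`,

(all four arguments lie in the upper half plane when `Im z > 0`, so `𝓕` is analytic there and
continuous up to the real axis) and `g(z) = 1/(1+z) + 1/(1−z)`, and prove:

* `bookerIntegrand_scale` / `integral_bookerIntegrand_scale`: the substitution `x = d·y` turns
  `∫_0^d (Booker's integrand for d, w)` into `d · ∫_0^1 (integrand for 1, w/d)`;
* `integral_bookerIntegrand_one_of_im_ne_zero`: for `Im z ≠ 0`,
  `∫_0^1 log|(x+1+z)(x+1−z̄)/((x+z)(x−z̄))| dx = Re 𝓕(z)` (fundamental theorem of calculus, four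
  times, with the primitive `w log w − w` of the principal logarithm);
* `integral_bookerIntegrand_one_ofReal`: for real `z = u`, the integral equals
  `E(u) = (2+u)log(2+u) + (2−u)log(2−u) − 2(1+u)log(1+u) − 2(1−u)log(1−u)` (`integral_log`);
* conjugation symmetry of both sides of the inequality.

## References

* A. R. Booker, *Artin's conjecture, Turing's method, and the Riemann hypothesis*, Experiment.
  Math. 15 (2006), 385–407, Lemma 4.4 and its proof sketch.  [Booker2006]
* T. S. Trudgian, *Improvements to Turing's method*, Math. Comp. 80 (2011), Lemma 2.10.
  [Trudgian2011]
-/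

noncomputable section

open Complex MeasureTheory intervalIntegral
open scoped ComplexConjugate

namespace Literature.NumberTheory.LFunctions

/-! ### The analytic functions of Booker's proof -/

/-- `Λ₀(w) = w log w − w`, a primitive of the principal logarithm on the slit plane. [folklore] -/
def bookerPrim (w : ℂ) : ℂ := w * log w - w

/-- Booker's `f`, rewritten with all logarithms taken in the upper half plane:
`𝓕(z) = (z+2)log(z+2) − (z−2)log(z−2) − 2(z+1)log(z+1) + 2(z−1)log(z−1)`.
For `Im z > 0`, `Re 𝓕(z) = ∫_0^1 log|(x+1+z)(x+1−z̄)/((x+z)(x−z̄))| dx`.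
[cite: Booker2006, Lemma 4.4 (proof)] -/
def bookerF (z : ℂ) : ℂ :=
  (z + 2) * log (z + 2) - (z - 2) * log (z - 2) - 2 * ((z + 1) * log (z + 1))
    + 2 * ((z - 1) * log (z - 1))

/-- Booker's `g(z) = 1/(1+z) + 1/(1−z)`. [cite: Booker2006, Lemma 4.4 (proof)] -/
def bookerG (z : ℂ) : ℂ := 1 / (1 + z) + 1 / (1 - z)

/-- Booker's `f − (log 4)·g` (upper-half-plane version): `H = 𝓕 − log 4 · g`.
[cite: Booker2006, Lemma 4.4 (proof)] -/
def bookerH (z : ℂ) : ℂ := bookerF z - (Real.log 4 : ℝ) * bookerG z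

/-- The real-axis value `E(u) = (2+u)log(2+u) + (2−u)log(2−u) − 2(1+u)log(1+u) − 2(1−u)log(1−u)`
of Booker's integral. [cite: Booker2006, Lemma 4.4 (proof)] -/
def bookerE (u : ℝ) : ℝ :=
  (2 + u) * Real.log (2 + u) + (2 - u) * Real.log (2 - u) - 2 * ((1 + u) * Real.log (1 + u))
    - 2 * ((1 - u) * Real.log (1 - u))

/-- `Λ₀' = log` on the slit plane. [folklore] -/
theorem hasDerivAt_bookerPrim {w : ℂ} (hw : w ∈ slitPlane) : HasDerivAt bookerPrim (log w) w := by
  have h0 : w ≠ 0 := slitPlane_ne_zero hw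
  have h1 : HasDerivAt (fun w : ℂ => w * log w - w) (1 * log w + w * w⁻¹ - 1) w :=
    ((hasDerivAt_id w).fun_mul (Complex.hasDerivAt_log hw)).fun_sub (hasDerivAt_id w)
  have h2 : (1 * log w + w * w⁻¹ - 1) = log w := by
    rw [mul_inv_cancel₀ h0]; ring
  rw [h2] at h1
  exact h1

/-- `x + a` lies in the slit plane for real `x` when `Im a ≠ 0`. [folklore] -/
theorem ofReal_add_mem_slitPlane {a : ℂ} (ha : a.im ≠ 0) (x : ℝ) : (x : ℂ) + a ∈ slitPlane :=
  mem_slitPlane_iff.mpr (Or.inr (by simpa using ha))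

/-- `a − x` lies in the slit plane for real `x` when `Im a ≠ 0`. [folklore] -/
theorem sub_ofReal_mem_slitPlane {a : ℂ} (ha : a.im ≠ 0) (x : ℝ) : a - (x : ℂ) ∈ slitPlane :=
  mem_slitPlane_iff.mpr (Or.inr (by simpa using ha))

/-- `x ↦ log(x + a)` is continuous on `ℝ` when `Im a ≠ 0`. [folklore] -/
theorem continuous_clog_ofReal_add {a : ℂ} (ha : a.im ≠ 0) :
    Continuous fun x : ℝ => log ((x : ℂ) + a) := by
  have hg : Continuous fun y : ℝ => (y : ℂ) + a := by fun_prop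
  exact continuous_iff_continuousAt.mpr fun x =>
    ContinuousAt.comp (g := log) (f := fun y : ℝ => (y : ℂ) + a)
      (continuousAt_clog (ofReal_add_mem_slitPlane ha x)) hg.continuousAt

/-- `x ↦ log(a − x)` is continuous on `ℝ` when `Im a ≠ 0`. [folklore] -/
theorem continuous_clog_sub_ofReal {a : ℂ} (ha : a.im ≠ 0) :
    Continuous fun x : ℝ => log (a - (x : ℂ)) := by
  have hg : Continuous fun y : ℝ => a - (y : ℂ) := by fun_prop
  exact continuous_iff_continuousAt.mpr fun x =>
    ContinuousAt.comp (g := log) (f := fun y : ℝ => a - (y : ℂ))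
      (continuousAt_clog (sub_ofReal_mem_slitPlane ha x)) hg.continuousAt

/-- `∫_0^1 log(x + a) dx = Λ₀(a+1) − Λ₀(a)` for `Im a ≠ 0`. [folklore] -/
theorem integral_clog_ofReal_add {a : ℂ} (ha : a.im ≠ 0) :
    ∫ x in (0:ℝ)..1, log ((x : ℂ) + a) = bookerPrim (a + 1) - bookerPrim a := by
  have hderiv : ∀ x ∈ Set.uIcc (0:ℝ) 1,
      HasDerivAt (fun y : ℝ => bookerPrim ((y : ℂ) + a)) (log ((x : ℂ) + a)) x := by
    intro x _
    have h1 : HasDerivAt (fun w : ℂ => bookerPrim (w + a)) (log ((x : ℂ) + a)) (x : ℂ) :=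
      HasDerivAt.comp_add_const (x : ℂ) a (hasDerivAt_bookerPrim (ofReal_add_mem_slitPlane ha x))
    exact h1.comp_ofReal
  rw [intervalIntegral.integral_eq_sub_of_hasDerivAt hderiv
    ((continuous_clog_ofReal_add ha).intervalIntegrable _ _)]
  simp only [Complex.ofReal_one, Complex.ofReal_zero, zero_add]
  rw [add_comm]

/-- `∫_0^1 log(a − x) dx = Λ₀(a) − Λ₀(a−1)` for `Im a ≠ 0`. [folklore] -/
theorem integral_clog_sub_ofReal {a : ℂ} (ha : a.im ≠ 0) :
    ∫ x in (0:ℝ)..1, log (a - (x : ℂ)) = bookerPrim a - bookerPrim (a - 1) := by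
  have hderiv : ∀ x ∈ Set.uIcc (0:ℝ) 1,
      HasDerivAt (fun y : ℝ => -bookerPrim (a - (y : ℂ))) (log (a - (x : ℂ))) x := by
    intro x _
    have h1 : HasDerivAt (fun w : ℂ => -bookerPrim (a - w)) (log (a - (x : ℂ))) (x : ℂ) := by
      have := (HasDerivAt.comp_const_sub a (x : ℂ)
        (hasDerivAt_bookerPrim (sub_ofReal_mem_slitPlane ha x))).fun_neg
      simpa using this
    exact h1.comp_ofReal
  rw [intervalIntegral.integral_eq_sub_of_hasDerivAt hderiv
    ((continuous_clog_sub_ofReal ha).intervalIntegrable _ _)]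
  simp only [Complex.ofReal_one, Complex.ofReal_zero, sub_zero]
  ring

/-! ### Scaling `x = d·y`, `z = w/d` -/

/-- Booker's integrand is homogeneous: `(integrand for d, w)(d·x) = (integrand for 1, w/d)(x)`.
[cite: Trudgian2011, Lemma 2.10 (proof: "the adaptation … is straightforward")] -/
theorem bookerIntegrand_scale {d : ℝ} (hd : d ≠ 0) (w : ℂ) (x : ℝ) :
    bookerIntegrand d w (d * x) = bookerIntegrand 1 (w / d) x := by
  have hd' : (d : ℂ) ≠ 0 := Complex.ofReal_ne_zero.mpr hd
  have hd2 : (d : ℂ) ^ 2 ≠ 0 := pow_ne_zero 2 hd'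
  simp only [bookerIntegrand, map_div₀, Complex.conj_ofReal, Complex.ofReal_mul, Complex.ofReal_one]
  have e1 : ((d : ℂ) * x + d + w) * ((d : ℂ) * x + d - conj w)
      = (d : ℂ) ^ 2 * (((x : ℂ) + 1 + w / d) * ((x : ℂ) + 1 - conj w / d)) := by
    field_simp
  have e2 : ((d : ℂ) * x + w) * ((d : ℂ) * x - conj w)
      = (d : ℂ) ^ 2 * (((x : ℂ) + w / d) * ((x : ℂ) - conj w / d)) := by
    field_simp
  rw [e1, e2, mul_div_mul_left _ _ hd2]

/-- `∫_0^d (integrand for d, w) = d · ∫_0^1 (integrand for 1, w/d)` for `d > 0`.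
[cite: Trudgian2011, Lemma 2.10 (proof)] -/
theorem integral_bookerIntegrand_scale {d : ℝ} (hd : 0 < d) (w : ℂ) :
    ∫ x in (0:ℝ)..d, bookerIntegrand d w x = d * ∫ x in (0:ℝ)..1, bookerIntegrand 1 (w / d) x := by
  have h := intervalIntegral.smul_integral_comp_mul_left (fun x => bookerIntegrand d w x) d
    (a := 0) (b := 1)
  simp only [mul_zero, mul_one, smul_eq_mul] at h
  rw [← h]
  congr 1
  refine intervalIntegral.integral_congr fun x _ => ?_
  exact bookerIntegrand_scale hd.ne' w x

/-! ### Evaluation for `Im z ≠ 0` -/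

/-- Pointwise: for `Im z ≠ 0`, Booker's integrand (with `d = 1`) is the real part of
`log(x+1+z) + log(z−1−x) − log(x+z) − log(z−x)`. [cite: Booker2006, Lemma 4.4 (proof)] -/
theorem bookerIntegrand_one_eq_re {z : ℂ} (hz : z.im ≠ 0) (x : ℝ) :
    bookerIntegrand 1 z x =
      (log ((x : ℂ) + 1 + z) + log (z - 1 - x) - log ((x : ℂ) + z) - log (z - x)).re := by
  have hA : (x : ℂ) + 1 + z ≠ 0 := fun h => hz (by simpa using congrArg Complex.im h)
  have hB : (x : ℂ) + 1 - conj z ≠ 0 := fun h => hz (by simpa using congrArg Complex.im h)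
  have hC : (x : ℂ) + z ≠ 0 := fun h => hz (by simpa using congrArg Complex.im h)
  have hD : (x : ℂ) - conj z ≠ 0 := fun h => hz (by simpa using congrArg Complex.im h)
  have hB' : ‖(x : ℂ) + 1 - conj z‖ = ‖z - 1 - x‖ := by
    have : (x : ℂ) + 1 - conj z = conj (x + 1 - z) := by simp [map_sub, map_add]
    rw [this, Complex.norm_conj, show (x : ℂ) + 1 - z = -(z - 1 - x) by ring, norm_neg]
  have hD' : ‖(x : ℂ) - conj z‖ = ‖z - x‖ := by
    have : (x : ℂ) - conj z = conj (x - z) := by simp [map_sub]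
    rw [this, Complex.norm_conj, show (x : ℂ) - z = -(z - x) by ring, norm_neg]
  simp only [bookerIntegrand, Complex.ofReal_one, Complex.sub_re, Complex.add_re, Complex.log_re]
  rw [norm_div, norm_mul, norm_mul, Real.log_div (mul_ne_zero (norm_ne_zero_iff.mpr hA)
    (norm_ne_zero_iff.mpr hB)) (mul_ne_zero (norm_ne_zero_iff.mpr hC) (norm_ne_zero_iff.mpr hD)),
    Real.log_mul (norm_ne_zero_iff.mpr hA) (norm_ne_zero_iff.mpr hB),
    Real.log_mul (norm_ne_zero_iff.mpr hC) (norm_ne_zero_iff.mpr hD), hB', hD']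
  ring

/-- The complex integral behind Booker's `f`: for `Im z ≠ 0`,
`∫_0^1 [log(x+1+z) + log(z−1−x) − log(x+z) − log(z−x)] dx = 𝓕(z)`.
[cite: Booker2006, Lemma 4.4 (proof)] -/
theorem integral_bookerLogs {z : ℂ} (hz : z.im ≠ 0) :
    ∫ x in (0:ℝ)..1, (log ((x : ℂ) + 1 + z) + log (z - 1 - x) - log ((x : ℂ) + z) - log (z - x))
      = bookerF z := by
  have hz1 : (z + 1).im ≠ 0 := by simpa using hz
  have hz2 : (z - 1).im ≠ 0 := by simpa using hz
  have i1 : IntervalIntegrable (fun x : ℝ => log ((x : ℂ) + 1 + z)) volume 0 1 := by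
    have h0 : IntervalIntegrable (fun x : ℝ => log ((x : ℂ) + (z + 1))) volume 0 1 :=
      (continuous_clog_ofReal_add hz1).intervalIntegrable 0 1
    refine h0.congr fun x _ => ?_
    ring_nf
  have i2 : IntervalIntegrable (fun x : ℝ => log (z - 1 - (x : ℂ))) volume 0 1 :=
    (continuous_clog_sub_ofReal hz2).intervalIntegrable 0 1
  have i3 : IntervalIntegrable (fun x : ℝ => log ((x : ℂ) + z)) volume 0 1 :=
    (continuous_clog_ofReal_add hz).intervalIntegrable 0 1
  have i4 : IntervalIntegrable (fun x : ℝ => log (z - (x : ℂ))) volume 0 1 :=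
    (continuous_clog_sub_ofReal hz).intervalIntegrable 0 1
  rw [intervalIntegral.integral_sub ((i1.add i2).sub i3) i4,
    intervalIntegral.integral_sub (i1.add i2) i3, intervalIntegral.integral_add i1 i2]
  have e1 : ∫ x in (0:ℝ)..1, log ((x : ℂ) + 1 + z) = bookerPrim (z + 2) - bookerPrim (z + 1) := by
    have h := integral_clog_ofReal_add hz1
    rw [show z + 1 + 1 = z + 2 by ring] at h
    rw [← h]
    refine intervalIntegral.integral_congr fun x _ => ?_
    ring_nf
  have e2 : ∫ x in (0:ℝ)..1, log (z - 1 - (x : ℂ)) = bookerPrim (z - 1) - bookerPrim (z - 2) := by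
    have h := integral_clog_sub_ofReal hz2
    rw [show z - 1 - 1 = z - 2 by ring] at h
    exact h
  have e3 : ∫ x in (0:ℝ)..1, log ((x : ℂ) + z) = bookerPrim (z + 1) - bookerPrim z :=
    integral_clog_ofReal_add hz
  have e4 : ∫ x in (0:ℝ)..1, log (z - (x : ℂ)) = bookerPrim z - bookerPrim (z - 1) :=
    integral_clog_sub_ofReal hz
  rw [e1, e2, e3, e4]
  simp only [bookerPrim, bookerF]
  ring

/-- **Evaluation of Booker's integral off the real axis**: for `Im z ≠ 0`,
`∫_0^1 log|(x+1+z)(x+1−z̄)/((x+z)(x−z̄))| dx = Re 𝓕(z)`.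
[cite: Booker2006, Lemma 4.4 (proof)] -/
theorem integral_bookerIntegrand_one_of_im_ne_zero {z : ℂ} (hz : z.im ≠ 0) :
    ∫ x in (0:ℝ)..1, bookerIntegrand 1 z x = (bookerF z).re := by
  have hz1 : (z + 1).im ≠ 0 := by simpa using hz
  have hz2 : (z - 1).im ≠ 0 := by simpa using hz
  have i1 : IntervalIntegrable (fun x : ℝ => log ((x : ℂ) + 1 + z)) volume 0 1 := by
    have h0 : IntervalIntegrable (fun x : ℝ => log ((x : ℂ) + (z + 1))) volume 0 1 :=
      (continuous_clog_ofReal_add hz1).intervalIntegrable 0 1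
    refine h0.congr fun x _ => ?_
    ring_nf
  have i2 : IntervalIntegrable (fun x : ℝ => log (z - 1 - (x : ℂ))) volume 0 1 :=
    (continuous_clog_sub_ofReal hz2).intervalIntegrable 0 1
  have i3 : IntervalIntegrable (fun x : ℝ => log ((x : ℂ) + z)) volume 0 1 :=
    (continuous_clog_ofReal_add hz).intervalIntegrable 0 1
  have i4 : IntervalIntegrable (fun x : ℝ => log (z - (x : ℂ))) volume 0 1 :=
    (continuous_clog_sub_ofReal hz).intervalIntegrable 0 1
  have hI : IntervalIntegrable (fun x : ℝ =>
      log ((x : ℂ) + 1 + z) + log (z - 1 - x) - log ((x : ℂ) + z) - log (z - x)) volume 0 1 :=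
    ((i1.add i2).sub i3).sub i4
  rw [intervalIntegral.integral_congr (fun x _ => bookerIntegrand_one_eq_re hz x)]
  have h := Complex.reCLM.intervalIntegral_comp_comm hI
  simp only [Complex.reCLM_apply] at h
  rw [h, integral_bookerLogs hz]

/-! ### Evaluation on the real axis -/

/-- `∫_0^1 log(x + c) dx = (1+c)log(1+c) − c log c − 1` for every real `c` (Lean's `log`
is `log |·|`, integrable through `0`). [folklore] -/
theorem integral_real_log_add (c : ℝ) :
    ∫ x in (0:ℝ)..1, Real.log (x + c) = (1 + c) * Real.log (1 + c) - c * Real.log c - 1 := by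
  rw [intervalIntegral.integral_comp_add_right (fun x => Real.log x) c, integral_log]
  simp only [zero_add]
  ring

/-- **Evaluation of Booker's integral on the real axis**: for real `u`,
`∫_0^1 log|(x+1+u)(x+1−u)/((x+u)(x−u))| dx = E(u)`. [cite: Booker2006, Lemma 4.4 (proof:
"on the real axis we calculate the integral explicitly")] -/
theorem integral_bookerIntegrand_one_ofReal (u : ℝ) :
    ∫ x in (0:ℝ)..1, bookerIntegrand 1 (u : ℂ) x = bookerE u := by
  have hae : ∀ᵐ x ∂volume, x ∈ Set.uIoc (0:ℝ) 1 → bookerIntegrand 1 (u : ℂ) x =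
      Real.log (x + (1 + u)) + Real.log (x + (1 - u)) - Real.log (x + u) - Real.log (x + -u) := by
    have hcount : ({-(1 + u), -(1 - u), -u, u} : Set ℝ).Countable := Set.toFinite _ |>.countable
    filter_upwards [hcount.ae_notMem volume] with x hx _
    simp only [Set.mem_insert_iff, Set.mem_singleton_iff, not_or] at hx
    obtain ⟨h1, h2, h3, h4⟩ := hx
    have h1' : x + (1 + u) ≠ 0 := fun h => h1 (by linarith)
    have h2' : x + (1 - u) ≠ 0 := fun h => h2 (by linarith)
    have h3' : x + u ≠ 0 := fun h => h3 (by linarith)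
    have h4' : x + -u ≠ 0 := fun h => h4 (by linarith)
    simp only [bookerIntegrand, Complex.conj_ofReal, Complex.ofReal_one]
    have : ((x : ℂ) + 1 + u) * ((x : ℂ) + 1 - u) / (((x : ℂ) + u) * ((x : ℂ) - u))
        = (((x + (1 + u)) * (x + (1 - u)) / ((x + u) * (x + -u)) : ℝ) : ℂ) := by
      push_cast; ring
    rw [this, Complex.norm_real, Real.norm_eq_abs, Real.log_abs,
      Real.log_div (mul_ne_zero h1' h2') (mul_ne_zero h3' h4'), Real.log_mul h1' h2',
      Real.log_mul h3' h4']
    ring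
  rw [intervalIntegral.integral_congr_ae hae]
  have hint : ∀ c : ℝ, IntervalIntegrable (fun x : ℝ => Real.log (x + c)) volume 0 1 := by
    intro c
    have h := (intervalIntegral.intervalIntegrable_log' (a := 0 + c) (b := 1 + c)).comp_add_right c
    simpa using h
  rw [intervalIntegral.integral_sub (((hint _).add (hint _)).sub (hint _)) (hint _),
    intervalIntegral.integral_sub ((hint _).add (hint _)) (hint _),
    intervalIntegral.integral_add (hint _) (hint _),
    integral_real_log_add, integral_real_log_add, integral_real_log_add, integral_real_log_add]
  simp only [bookerE, Real.log_neg_eq_log]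
  ring_nf

/-! ### Conjugation symmetry -/

/-- Booker's integrand is invariant under `w ↦ w̄`. [folklore] -/
theorem bookerIntegrand_conj (d : ℝ) (w : ℂ) (x : ℝ) :
    bookerIntegrand d (conj w) x = bookerIntegrand d w x := by
  simp only [bookerIntegrand, Complex.conj_conj]
  rw [← Complex.norm_conj]
  simp only [map_div₀, map_mul, map_sub, map_add, Complex.conj_ofReal, Complex.conj_conj]

/-- The right-hand side `Re(1/(d+w) + 1/(d−w̄))` is invariant under `w ↦ w̄`. [folklore] -/
theorem booker_rhs_conj (d : ℝ) (w : ℂ) :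
    (1 / ((d : ℂ) + conj w)).re + (1 / ((d : ℂ) - conj (conj w))).re
      = (1 / ((d : ℂ) + w)).re + (1 / ((d : ℂ) - conj w)).re := by
  have h1 : (1 / ((d : ℂ) + conj w)) = conj (1 / ((d : ℂ) + w)) := by
    simp [map_add, Complex.conj_ofReal]
  have h2 : (1 / ((d : ℂ) - conj (conj w))) = conj (1 / ((d : ℂ) - conj w)) := by
    simp [map_sub, Complex.conj_ofReal]
  rw [h1, h2, Complex.conj_re, Complex.conj_re]

/-- The right-hand side in terms of `g`: `Re(1/(1+z)) + Re(1/(1−z̄)) = Re g(z)`. [folklore] -/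
theorem booker_rhs_one_eq_re_bookerG (z : ℂ) :
    (1 / ((1 : ℝ) + z : ℂ)).re + (1 / (((1 : ℝ) : ℂ) - conj z)).re = (bookerG z).re := by
  have h2 : (1 / ((1 : ℂ) - conj z)) = conj (1 / (1 - z)) := by
    simp [map_sub]
  simp only [bookerG, Complex.ofReal_one, Complex.add_re]
  rw [h2, Complex.conj_re]

/-- Scaling of the right-hand side: `Re(1/(d+w)) + Re(1/(d−w̄)) = d⁻¹ · Re g(w/d)` for real
`d ≠ 0`. [cite: Trudgian2011, Lemma 2.10 (proof)] -/
theorem booker_rhs_scale {d : ℝ} (hd : d ≠ 0) (w : ℂ) :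
    (1 / ((d : ℂ) + w)).re + (1 / ((d : ℂ) - conj w)).re = d⁻¹ * (bookerG (w / d)).re := by
  have hd' : (d : ℂ) ≠ 0 := Complex.ofReal_ne_zero.mpr hd
  have h1 : (1 / ((d : ℂ) + w)) = (d⁻¹ : ℝ) * (1 / (1 + w / d)) := by
    push_cast
    field_simp
  have h2 : (1 / ((d : ℂ) - conj w)) = conj ((d⁻¹ : ℝ) * (1 / (1 - w / d))) := by
    simp only [map_mul, map_div₀, map_sub, map_one, Complex.conj_ofReal]
    push_cast
    field_simp
  rw [h1, h2, Complex.conj_re, Complex.re_ofReal_mul, Complex.re_ofReal_mul, bookerG,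
    Complex.add_re]
  ring

end Literature.NumberTheory.LFunctions
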